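import Summits.CriticalPhenomena.PercolationContinuityZ3.Theorems.PercNearOneGluingNoHeavyLowerTailSahiCombMinDegree
import Summits.CriticalPhenomena.PercolationContinuityZ3.Theorems.SahiMasterFamilySandwich

/-!
# The comb hierarchy for Sahi's `E_k`: (M⁺⁺) — minimal-multidegree comb positivity — for every family with at most two non-cylinder members

Support file of the one-cut programme (crux `NoHeavyLowerTail`, stmt-CriticalPhenomena-4575; cell `prim-masterthm`, seat P5 gen 4; report
`P5-LORENTZIAN-TEST.md` §9).  `…SahiCombMinDegree` typed (M⁺⁺-k) (`MasterFamilyCombMinDegPos k`: `p ↦ E_k(μ_p; 1_U)` is comb-positive at the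
MINIMAL multidegree `r_e = #{i : e ∈ esupp U_i}`) and proved it for `k ≤ 2` and for cylinder families; `…SahiCombCylinderMinDegree` re-ran the
freeze/conditioning induction of `…SahiCombCylinder` (seat P3) with exact degrees for cylinders.  Here the same induction is run for GENERAL
increasing members (every factor carried at its essential support `esupp`, `combPos_ex_ind_supported`; intersections and set-sections only shrink
essential supports), giving the minimal-degree versions of P3's cylinder rung and two-free-slot theorem:

* `combPos_negSahiE_freezeDiff_minDeg` — `[n = 0] − E^{μ_p − μ_{p[Q↦1]}}_n(1_V)` is comb-positive at `Σ_j 1_{esupp V_j}` for every increasing family;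
* `combPos_head_minDeg` — the cylinder head step at minimal degree (local hypotheses on the sectioned sub-families);
* **`combPos_sahiE_ind_allButTwoCylinders_minDeg`** — UNCONDITIONAL, every `n`: a family of `n` increasing events all but at most two of which are
  cylinders is comb-positive at its MINIMAL multidegree (base: (M⁺⁺-2) of `…SahiCombMinDegree`); `combPos_sahiE_ind_cylinder_head_minDeg` — GIVEN
  (M⁺⁺-j) for `j ≤ k`, (M⁺⁺) for `(cylinder, U_0,…,U_{k−1})`.
HONEST LABEL: (M⁺⁺-k) / (M⁺-k) for general increasing events remain OPEN (k ≥ 3). [this work]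
-/

noncomputable section

open scoped Classical

namespace Summit.CriticalPhenomena.PercolationContinuityZ3.Theorems

open Finset Function
open Literature.Combinatorics.Sahi2008
open Literature.Probability.LatticeModels.Kahn2022 (Affects)
open Literature.Probability.Percolation (DeterminedBy determinedBy_iff)
open Literature.Probability.Percolation.DecisionTree (ind ind_of_mem ind_of_not_mem ind_nonneg)
open SahiComb SahiCylinderIdentity SahiMomentExpansion SahiCylMinDeg

namespace SahiMinDeg

variable {ι : Type} [Fintype ι]

/-! ### Essential supports of intersections and set-sections -/

omit [Fintype ι] in
/-- A coordinate pivotal for the set-section `V^{S←1}` lies outside `S` and is pivotal for `V`. [folklore] -/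
theorem affects_of_affects_secUnion {S : Set ι} {V : Set (Set ι)} {e : ι} (h : Affects (secUnion S V) e) : e ∉ S ∧ Affects V e := by
  obtain ⟨ω, hω, hins⟩ := h
  rw [mem_secUnion] at hω hins
  have heS : e ∉ S := fun heS => hω (by rwa [Set.insert_union, Set.insert_eq_of_mem (Set.mem_union_right ω heS)] at hins)
  refine ⟨heS, ω ∪ S, hω, ?_⟩
  rwa [Set.insert_union] at hins

/-- `esupp (V^{S←1}) ⊆ esupp V`, and it avoids `S`. [folklore] -/
theorem mem_esupp_of_mem_esupp_secUnion {S : Set ι} {V : Set (Set ι)} {e : ι} (h : e ∈ esupp (secUnion S V)) :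
    e ∉ S ∧ e ∈ esupp V := by
  rw [mem_esupp] at h ⊢
  exact affects_of_affects_secUnion h

/-! ### Supported one-coordinate-free factors -/

/-- `P_p(V^{Q←1}) − P_p(V) = P_p(V^{Q←1} ∖ V)` is comb-positive at multidegree `1_{esupp V}`. [this work] -/
theorem combPos_secUnion_sub_supported (Q : Set ι) {V : Set (Set ι)} (hV : IsUpperSet V) :
    CombPos (fun e => if e ∈ esupp V then 1 else 0)
      (fun p => ex (bernoulliWeight p) (ind (secUnion Q V)) - ex (bernoulliWeight p) (ind V)) := by
  have h1 := combPos_ex_secUnion_sub Q hV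
  have hdV : DeterminedBy V (↑(esupp V) : Set ι) := determinedBy_esupp hV
  have hdS : DeterminedBy (secUnion Q V) (↑(esupp V) : Set ι) := by
    rw [determinedBy_iff] at hdV ⊢
    intro ω ω' h
    rw [mem_secUnion, mem_secUnion]
    exact hdV _ _ (by rw [Set.union_inter_distrib_right, Set.union_inter_distrib_right, h])
  have h2 := SahiCombSubstitution.CombPos.of_ignores_finset (Finset.univ \ esupp V) (fun e' he' p s => by
    have hne : e' ∉ (↑(esupp V) : Set ι) := fun h => (Finset.mem_sdiff.1 he').2 (Finset.mem_coe.1 h)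
    simp only [SahiCombJunta.ex_ind_update_of_determinedBy p e' s hdS hne,
      SahiCombJunta.ex_ind_update_of_determinedBy p e' s hdV hne]) h1
  refine combPos_of_deg_eq h2 ?_
  funext e'; by_cases he : e' ∈ esupp V <;> simp [he]

omit [Fintype ι] in
/-- Degree of the merged family: replacing `V_l` by `V_l ∩ W` raises the essential-support multidegree by at most `1_{esupp W}`. [folklore] -/
theorem deg_update_inter_le [Fintype ι] {m : ℕ} (V : Fin m → Set (Set ι)) (l : Fin m) (W : Set (Set ι)) (e : ι) :
    (∑ j, if e ∈ esupp (update V l (V l ∩ W) j) then 1 else 0 : ℕ)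
      ≤ (if e ∈ esupp W then 1 else 0) + ∑ j, if e ∈ esupp (V j) then 1 else 0 := by
  have hl : ∀ j ∈ univ.erase l, (if e ∈ esupp (update V l (V l ∩ W) j) then 1 else 0 : ℕ) = if e ∈ esupp (V j) then 1 else 0 :=
    fun j hj => by rw [update_of_ne (Finset.ne_of_mem_erase hj)]
  rw [← Finset.add_sum_erase univ _ (mem_univ l), ← Finset.add_sum_erase univ (fun j => if e ∈ esupp (V j) then 1 else (0 : ℕ)) (mem_univ l),
    Finset.sum_congr rfl hl, update_self]
  have key : (if e ∈ esupp (V l ∩ W) then 1 else 0 : ℕ) ≤ (if e ∈ esupp W then 1 else 0) + (if e ∈ esupp (V l) then 1 else 0) := by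
    by_cases hI : e ∈ esupp (V l ∩ W)
    · rcases Finset.mem_union.1 (esupp_inter_subset (V l) W hI) with h | h <;> simp [hI, h]
    · simp [hI]
  omega

/-! ### The frozen difference on an increasing family, minimal degree -/

/-- **`[n = 0] − E^ν_n(1_{V_0},…,1_{V_{n−1}})` is comb-positive at multidegree `Σ_j 1_{esupp V_j}`** for increasing `V_j` and
`ν = μ_p − μ_{p[Q↦1]}` (`combPos_negSahiE_freezeDiff` of seat P3 with exact degrees). [this work] -/
theorem combPos_negSahiE_freezeDiff_minDeg (Q : Set ι) :
    ∀ (n : ℕ) (V : Fin n → Set (Set ι)), (∀ j, IsUpperSet (V j)) →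
      CombPos (fun e => ∑ j, if e ∈ esupp (V j) then 1 else 0)
        (fun p => (if n = 0 then (1 : ℝ) else 0) - sahiE (freezeDiff Q p) n (fun j => ind (V j)))
  | 0, V, _ => (combPos_const _ zero_le_one).congr fun p => by rw [if_pos rfl, sahiE_zero, sub_zero]
  | 1, V, hV => by
    have hdeg : (fun e => ∑ j : Fin 1, if e ∈ esupp (V j) then 1 else (0 : ℕ)) = fun e => if e ∈ esupp (V 0) then 1 else 0 := by
      funext e; rw [Fin.sum_univ_one]
    rw [hdeg]
    refine (combPos_secUnion_sub_supported Q (hV 0)).congr fun p => ?_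
    rw [if_neg one_ne_zero, zero_sub, sahiE_one_apply, neg_ex_freezeDiff_ind]
  | n + 2, V, hV => by
    set W : Set (Set ι) := V 0 with hW
    set T : Fin (n + 1) → Set (Set ι) := fun j => V j.succ with hT
    set D : ι → ℕ := fun e => ∑ j, if e ∈ esupp (V j) then 1 else 0 with hD
    have hfam : (fun j => ind (V j)) = Matrix.vecCons (ind W) (fun j => ind (T j)) := by
      funext j; refine Fin.cases rfl (fun i => rfl) j
    have hDsplit : ∀ e, D e = (if e ∈ esupp W then 1 else 0) + ∑ j, if e ∈ esupp (T j) then 1 else 0 := fun e => by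
      simp only [hD, hW, hT, Fin.sum_univ_succ]
    have hTup : ∀ j, IsUpperSet (T j) := fun j => hV _
    have hupd : ∀ l j, IsUpperSet (update T l (T l ∩ W) j) := fun l j => by
      by_cases hj : j = l
      · subst hj; rw [update_self]; exact (hTup j).inter (hV 0)
      · rw [update_of_ne hj]; exact hTup j
    have htail : ∀ l : Fin (n + 1), CombPos D (fun p => (if n + 1 = 0 then (1 : ℝ) else 0) -
        sahiE (freezeDiff Q p) (n + 1) (fun j => ind (update T l (T l ∩ W) j))) := fun l =>
      (combPos_negSahiE_freezeDiff_minDeg Q (n + 1) (update T l (T l ∩ W)) (hupd l)).mono fun e => by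
        rw [hDsplit]; exact deg_update_inter_le T l W e
    have hrest : CombPos (fun e => ∑ j, if e ∈ esupp (T j) then 1 else 0) (fun p => (if n + 1 = 0 then (1 : ℝ) else 0) -
        sahiE (freezeDiff Q p) (n + 1) (fun j => ind (T j))) :=
      combPos_negSahiE_freezeDiff_minDeg Q (n + 1) T hTup
    have hδ : CombPos (fun e => if e ∈ esupp W then 1 else 0) (fun p => - ex (freezeDiff Q p) (ind W)) :=
      (combPos_secUnion_sub_supported Q (hV 0)).congr fun p => neg_ex_freezeDiff_ind Q p _
    have hdeg : (fun e => ∑ j, if e ∈ esupp (T j) then 1 else (0 : ℕ)) + (fun e => if e ∈ esupp W then 1 else 0) = D := by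
      funext e; rw [Pi.add_apply, hDsplit, add_comm]
    have htot := (CombPos.sum univ fun l _ => htail l).add (hrest.mul_of_eq hδ hdeg)
    refine htot.congr fun p => ?_
    simp only [if_neg (Nat.succ_ne_zero _), zero_sub]
    rw [hfam, sahiE_cons]
    simp only [← ind_update_inter, Finset.sum_neg_distrib]
    ring

/-- `polyB` of the frozen difference on an increasing family: comb-positive at the essential support of the sub-family. [this work] -/
theorem combPos_polyB_freezeDiff_minDeg (Q : Set ι) {k : ℕ} (U : Fin k → Set (Set ι)) (hU : ∀ j, IsUpperSet (U j)) (A : Finset (Fin k)) :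
    CombPos (fun e => ∑ j ∈ A, if e ∈ esupp (U j) then 1 else 0)
      (fun p => polyB (freezeDiff Q p) (fun j => ind (U j)) A) := by
  have h := combPos_negSahiE_freezeDiff_minDeg Q A.card (fun j => U (A.orderEmbOfFin rfl j)) fun j => hU _
  have hdeg : (fun e => ∑ j : Fin A.card, if e ∈ esupp (U (A.orderEmbOfFin rfl j)) then 1 else (0 : ℕ)) =
      fun e => ∑ j ∈ A, if e ∈ esupp (U j) then 1 else 0 := by
    funext e; exact sum_orderEmbOfFin' A (fun j => if e ∈ esupp (U j) then 1 else (0 : ℕ))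
  refine (combPos_of_deg_eq h hdeg).congr fun p => ?_
  unfold polyB
  simp only [Finset.card_eq_zero]

/-! ### The head step and the two-free-slot theorem at minimal degree -/

/-- **Cylinder head step at minimal degree (local form).**  If every sectioned sub-family `(U_j^{R←1})_{j ∈ A}` is comb-positive at its own
essential support, then `E_{k+1}(μ_p; 1_{[R]}, 1_{U_0},…,1_{U_{k−1}})` is comb-positive at `1_R + Σ_j 1_{esupp U_j}`. [this work] -/
theorem combPos_head_minDeg (R : Set ι) {k : ℕ} (U : Fin k → Set (Set ι)) (hU : ∀ j, IsUpperSet (U j))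
    (hsub : ∀ A : Finset (Fin k), CombPos (fun e => ∑ j ∈ A, if e ∈ esupp (secUnion R (U j)) then 1 else 0)
      (fun p => sahiE (bernoulliWeight p) A.card (fun j => ind (secUnion R (U (A.orderEmbOfFin rfl j)))))) :
    CombPos (fun e => (if e ∈ R then 1 else 0) + ∑ j, if e ∈ esupp (U j) then 1 else 0)
      (fun p => sahiE (bernoulliWeight p) (k + 1) (Matrix.vecCons (ind {ω : Set ι | R ⊆ ω}) (fun j => ind (U j)))) := by
  set Dsum : ι → ℕ := fun e => ∑ j, if e ∈ esupp (U j) then 1 else 0 with hDsum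
  have hterm : ∀ A ∈ (univ : Finset (Finset (Fin k))), CombPos Dsum
      (fun p => markedA (bernoulliWeight fun e => if e ∈ R then 1 else p e) 1 (fun j => ind (U j)) A *
        polyB (freezeDiff R p) (fun j => ind (U j)) Aᶜ) := fun A _ =>
    ((combPos_markedA_one_deg R U A (hsub A)).mul (combPos_polyB_freezeDiff_minDeg R U hU Aᶜ)).mono fun e => by
      simp only [Pi.add_apply, hDsum]
      have h1 : (∑ j ∈ A, (if e ∈ esupp (secUnion R (U j)) then 1 else 0 : ℕ)) ≤ ∑ j ∈ A, (if e ∈ esupp (U j) then 1 else 0 : ℕ) :=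
        Finset.sum_le_sum fun j _ => by
          by_cases h1 : e ∈ esupp (secUnion R (U j))
          · rw [if_pos h1, if_pos (mem_esupp_of_mem_esupp_secUnion h1).2]
          · rw [if_neg h1]; exact Nat.zero_le _
      have h2 := Finset.sum_add_sum_compl A (fun j => (if e ∈ esupp (U j) then 1 else 0 : ℕ))
      omega
  have htot := (combPos_ex_ind_cyl R).mul_of_eq (CombPos.sum univ hterm) (m := fun e => (if e ∈ R then 1 else 0) + Dsum e) rfl
  refine htot.congr fun p => ?_
  have hid := sahiE_marked_eq (bernoulliWeight p) (bernoulliWeight fun e => if e ∈ R then 1 else p e) (freezeDiff R p)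
    (ind {ω : Set ι | R ⊆ ω}) (∏ e, if e ∈ R then (p e : ℝ) else 1) (fun _ => rfl) (ex_ind_cylinder_mul p R) k 1
    (fun j => ind (U j))
  rw [mul_one] at hid
  rw [hid, ex_ind_cylinder_eq_prod]

/-- Re-indexing the essential-support multidegree of a family along `vecCons`-type splittings: `Σ_j 1_{esupp U_j}` for `j : Fin (k+2)` through
the pivot `m` and a permutation of the rest. [folklore] -/
theorem deg_succAbove {k : ℕ} (U : Fin (k + 2) → Set (Set ι)) (m : Fin (k + 2)) (τ : Equiv.Perm (Fin (k + 1))) (e : ι) :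
    (∑ j, if e ∈ esupp (U j) then 1 else (0 : ℕ))
      = (if e ∈ esupp (U m) then 1 else 0) + ∑ j, if e ∈ esupp (U (m.succAbove (τ j))) then 1 else 0 := by
  rw [Fin.sum_univ_succAbove _ m]
  congr 1
  exact (Equiv.sum_comp τ (fun j => if e ∈ esupp (U (m.succAbove j)) then 1 else (0 : ℕ))).symm

/-- **Families with at most two non-cylinder members are comb-positive at their MINIMAL multidegree, every `n`** (unconditional; base (M⁺⁺-2) of
`…SahiCombMinDegree`; the minimal-degree form of P3's `combPos_sahiE_ind_of_allButTwoCylinders`). [this work] -/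
theorem combPos_sahiE_ind_allButTwoCylinders_minDeg :
    ∀ (n : ℕ) (U : Fin n → Set (Set ι)), (∀ j, IsUpperSet (U j)) →
      (∃ E : Finset (Fin n), E.card ≤ 2 ∧ ∀ j, j ∉ E → ∃ S : Set ι, U j = {ω : Set ι | S ⊆ ω}) →
      CombPos (fun e => ∑ j, if e ∈ esupp (U j) then 1 else 0) (fun p => sahiE (bernoulliWeight p) n (fun j => ind (U j))) := by
  intro n
  induction n using Nat.strong_induction_on with
  | _ n ih =>
    intro U hU hE
    obtain ⟨E, hEcard, hcyl⟩ := hE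
    by_cases hn : n ≤ 2
    · exact masterFamilyCombMinDegPos_of_le_two hn ι U hU
    · have hex : ∃ m : Fin n, m ∉ E := by
        by_contra hall
        have hall' : ∀ j : Fin n, j ∈ E := fun j => by
          by_contra hj
          exact hall ⟨j, hj⟩
        have : (univ : Finset (Fin n)).card ≤ E.card := Finset.card_le_card fun j _ => hall' j
        rw [Finset.card_univ, Fintype.card_fin] at this
        omega
      obtain ⟨m, hmE⟩ := hex
      obtain ⟨S, hS⟩ := hcyl m hmE
      obtain ⟨k, rfl⟩ : ∃ k, n = k + 2 := ⟨n - 2, by omega⟩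
      obtain ⟨τ, hτ⟩ := exists_perm_forall_sahiE_ind_eq_cons U m
      set V : Fin (k + 1) → Set (Set ι) := fun j => U (m.succAbove (τ j)) with hV
      have hVup : ∀ j, IsUpperSet (V j) := fun j => hU _
      have hdeg : (fun e => ∑ j, if e ∈ esupp (U j) then 1 else (0 : ℕ))
          = fun e => (if e ∈ S then 1 else 0) + ∑ j, if e ∈ esupp (V j) then 1 else 0 := by
        funext e
        rw [deg_succAbove U m τ e, hS]
        simp only [mem_esupp_cylinder_iff, hV]
      rw [hdeg]
      have h := combPos_head_minDeg S V hVup fun A => ?_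
      · exact h.congr fun p => by rw [hτ (bernoulliWeight p), hS]
      · -- the sectioned sub-family: again at most two non-cylinder members; induction at its own essential support
        have hsub := ih A.card (lt_of_le_of_lt (by simpa using Finset.card_le_univ A) (by omega))
          (fun j => secUnion S (V (A.orderEmbOfFin rfl j)))
          (fun j => isUpperSet_secUnion S (hVup _)) ⟨univ.filter (fun j => m.succAbove (τ (A.orderEmbOfFin rfl j)) ∈ E), ?_, ?_⟩
        · refine combPos_of_deg_eq hsub ?_
          funext e
          rw [← sum_orderEmbOfFin' A (fun j => if e ∈ esupp (secUnion S (V j)) then (1 : ℕ) else 0)]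
        · calc (univ.filter (fun j : Fin A.card => m.succAbove (τ (A.orderEmbOfFin rfl j)) ∈ E)).card
              ≤ E.card := by
                refine Finset.card_le_card_of_injOn (fun j => m.succAbove (τ (A.orderEmbOfFin rfl j))) (fun j hj => ?_) ?_
                · exact (Finset.mem_filter.1 (Finset.mem_coe.1 hj)).2
                · intro a _ b _ hab
                  exact (A.orderEmbOfFin rfl).injective (τ.injective (Fin.succAbove_right_injective hab))
            _ ≤ 2 := hEcard
        · intro j hj
          have hj' : m.succAbove (τ (A.orderEmbOfFin rfl j)) ∉ E := fun h' => hj (Finset.mem_filter.2 ⟨mem_univ _, h'⟩)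
          obtain ⟨S', hS'⟩ := hcyl _ hj'
          exact ⟨S' \ S, by simp only [hV, hS', secUnion_cylinder]⟩

/-- **The cylinder rung at minimal degree, global form**: GIVEN (M⁺⁺-j) for all `j ≤ k`, (M⁺⁺) holds for `(1_{[S]}, 1_{U_0},…,1_{U_{k−1}})`.
[this work] -/
theorem combPos_sahiE_ind_cylinder_head_minDeg {k : ℕ} (hN : ∀ j, j ≤ k → MasterFamilyCombMinDegPos j) (S : Set ι)
    (U : Fin k → Set (Set ι)) (hU : ∀ j, IsUpperSet (U j)) :
    CombPos (fun e => (if e ∈ S then 1 else 0) + ∑ j, if e ∈ esupp (U j) then 1 else 0)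
      (fun p => sahiE (bernoulliWeight p) (k + 1) (Matrix.vecCons (ind {ω : Set ι | S ⊆ ω}) (fun j => ind (U j)))) :=
  combPos_head_minDeg S U hU fun A => by
    have h := hN A.card (by simpa using Finset.card_le_univ A) ι (fun j => secUnion S (U (A.orderEmbOfFin rfl j)))
      fun j => isUpperSet_secUnion S (hU _)
    refine combPos_of_deg_eq h ?_
    funext e
    rw [← sum_orderEmbOfFin' A (fun j => if e ∈ esupp (secUnion S (U j)) then (1 : ℕ) else 0)]

end SahiMinDeg

end Summit.CriticalPhenomena.PercolationContinuityZ3.Theorems
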